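import Mathlib
import Literature.Probability.Percolation.PercolationProofs
import Literature.Probability.LatticeModels.ProdBernoulliIndependence
import Literature.Probability.LatticeModels.ProdBernoulliClusterLocality
import Summits.CriticalPhenomena.PercolationContinuityZ3.Theorems.PercNearOneGluingAdditiveGluingSigmaLaw
import HarnessLib

/-! # Crux `PercNearOneGluing.AdditiveGluing` (stmt-CriticalPhenomena-4576), line
`sigma-recursion-lemma5-any-relay` — stub `stub_gluePushforward`

Helper file for the crux skeleton
`Cruxes/AdditiveGluing/Lines/sigma-recursion-lemma5-any-relay.lean` (lead
prover-line-stmt-CriticalPhenomena-4576-0).  Proves exactly the registered stub signature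
`stub_gluePushforward`; lands with `--supports stmt-CriticalPhenomena-4576`.

## Content

Contracting a block is a push-forward (Kozma–Nitzan arXiv:2401.12397 §3.1, Remark "gluing =
probability 1"): product-measure calculus on the finite configuration space
`BondConfig (Fin n) = Set (Sym2 (Fin n))`.  With `D_S := {e | (∀ x ∈ e, x ∈ S) ∧ ¬ e.IsDiag}`
(the non-loop pairs inside `S`) and `glue w S e := if e ∈ D_S then 1 else w e`, the law
`prodBernoulli (glue w S)` is the image of `prodBernoulli w` under `Φ_S ω := ω ∪ D_S`; hence
`μ_{glue w S}(E) = μ_w {ω | ω ∪ D_S ∈ E}` for every event `E`.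

## Proof outline

`Φ_S` acts coordinatewise: `e ∈ Φ_S ω ↔ φ_e (e ∈ ω)` with `φ_e P := P ∨ (e ∈ D_S)`.  A
coordinatewise map of a product of Bernoulli coins is the product of the mapped coins
(`sigmaLaw_prodBernoulli_map_coordwise`, landed in the sibling helper file
`PercNearOneGluingAdditiveGluingSigmaLaw.lean`, a transport of Mathlib's
`Measure.infinitePi_map_pi`), and the coin `Ber(True, False, w e)` mapped by `φ_e` is
`Ber(True, False, 1)` if `e ∈ D_S` and `Ber(True, False, w e)` otherwise
(`ProbabilityTheory.map_bernoulliMeasure`), i.e. the coin of `e` under `glue w S`.  Finally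
`Measure.map_apply` (everything is measurable on the finite discrete configuration space) turns
the identity of measures into the claimed identity of real masses.  [folklore; Grimmett 1999
§1.3 p. 10]
-/

namespace Summit.CriticalPhenomena.PercolationContinuityZ3.Theorems

open MeasureTheory Set
open Literature.Probability.LatticeModels (prodBernoulli)
open Literature.Probability.Percolation (BondConfig openConn openGraph)

noncomputable section
open Classical

section GluePushforward

open ProbabilityTheory

variable {n : ℕ}

/-- The one-coordinate computation behind the push-forward: the coin of the pair `e` under `w`,
mapped by `φ_e P := P ∨ (e is a non-loop pair inside S)`, is the coin of `e` under `glue w S`.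
[folklore] -/
theorem gluePush_map_coin (w : Sym2 (Fin n) → unitInterval) (S : Finset (Fin n))
    (e : Sym2 (Fin n)) :
    (Ber(True, False, w e)).map (fun P : Prop => P ∨ ((∀ x ∈ e, x ∈ S) ∧ ¬ e.IsDiag)) =
      Ber(True, False, (if (∀ x ∈ e, x ∈ S) ∧ ¬ e.IsDiag then 1 else w e)) := by
  rw [map_bernoulliMeasure]
  by_cases hS : (∀ x ∈ e, x ∈ S) ∧ ¬ e.IsDiag
  · have h1 : (True ∨ ((∀ x ∈ e, x ∈ S) ∧ ¬ e.IsDiag)) = True :=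
      propext (iff_true_intro (Or.inr hS))
    have h2 : (False ∨ ((∀ x ∈ e, x ∈ S) ∧ ¬ e.IsDiag)) = True :=
      propext (iff_true_intro (Or.inr hS))
    simp only [h1, h2, if_pos hS, bernoulliMeasure_self_eq_dirac, bernoulliMeasure_one]
  · have h1 : (True ∨ ((∀ x ∈ e, x ∈ S) ∧ ¬ e.IsDiag)) = True :=
      propext (iff_true_intro (Or.inl trivial))
    have h2 : (False ∨ ((∀ x ∈ e, x ∈ S) ∧ ¬ e.IsDiag)) = False :=
      propext (iff_false_intro (by rintro (h | h); exacts [h, hS h]))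
    simp only [h1, h2, if_neg hS]

/-- **The push-forward of `prodBernoulli w` under `ω ↦ ω ∪ D_S` is `prodBernoulli (glue w S)`.**
[folklore; Grimmett 1999 §1.3 p. 10; KN arXiv:2401.12397 §3.1] -/
theorem gluePush_map_union (w : Sym2 (Fin n) → unitInterval) (S : Finset (Fin n)) :
    (prodBernoulli w).map
        (fun ω : BondConfig (Fin n) =>
          (ω ∪ {e | (∀ x ∈ e, x ∈ S) ∧ ¬ e.IsDiag} : BondConfig (Fin n))) =
      prodBernoulli (fun e : Sym2 (Fin n) =>
        if (∀ x ∈ e, x ∈ S) ∧ ¬ e.IsDiag then 1 else w e) :=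
  sigmaLaw_prodBernoulli_map_coordwise w
    (fun e : Sym2 (Fin n) => if (∀ x ∈ e, x ∈ S) ∧ ¬ e.IsDiag then 1 else w e)
    (fun (e : Sym2 (Fin n)) (P : Prop) => P ∨ ((∀ x ∈ e, x ∈ S) ∧ ¬ e.IsDiag))
    (gluePush_map_coin w S)

/-- **stub_gluePushforward — contracting a block is a pushforward.**  The law
`prodBernoulli (glue w S)` (weight 1 on the non-loop pairs inside `S`) is the image of
`prodBernoulli w` under `ω ↦ ω ∪ D_S`, `D_S = {non-loop pairs inside S}`: for every event `E`,
`μ_{G/S}(E) = μ_G{ω | ω ∪ D_S ∈ E}` (coordinates outside `D_S` keep their weights, those in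
`D_S` are a.s. open under `glue w S`).  [folklore; Grimmett 1999 §1.3;
KN arXiv:2401.12397 §3.1 Remark "gluing = probability 1"] -/
theorem stub_gluePushforward :
    ∀ (n : ℕ) (w : Sym2 (Fin n) → unitInterval) (S : Finset (Fin n)) (E : Set (BondConfig (Fin n))),
      (prodBernoulli (fun e : Sym2 (Fin n) =>
          if (∀ x ∈ e, x ∈ S) ∧ ¬ e.IsDiag then 1 else w e)).real E =
        (prodBernoulli w).real
          {ω | (ω ∪ {e | (∀ x ∈ e, x ∈ S) ∧ ¬ e.IsDiag}) ∈ E} := by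
  intro n w S E
  have hmeas : Measurable fun ω : BondConfig (Fin n) =>
      (ω ∪ {e | (∀ x ∈ e, x ∈ S) ∧ ¬ e.IsDiag} : BondConfig (Fin n)) :=
    Measurable.of_discrete
  rw [measureReal_def, measureReal_def, ← gluePush_map_union w S,
    Measure.map_apply hmeas MeasurableSet.of_discrete]
  rfl

end GluePushforward

end

end Summit.CriticalPhenomena.PercolationContinuityZ3.Theorems
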